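import Mathlib

/-!
# Discrete intermediate value step (seat p4)

Kernel-checked form of the «path fact» (P1) used throughout the planar block (SHARP-p4 §0.4, T2-assembly-p4
Lemma 2.1, FOUNDATIONS-p5 (IVT)): an integer sequence whose consecutive terms differ by at most `1` and which
goes from a value `≤ r` to a value `≥ r` takes the value `r`. Applied to `i ↦ ‖x_i − v‖_∞` along a nearest-
neighbour path this says that a path from sup-distance `≤ r` to sup-distance `≥ r` from `v` meets the sphere
`v + ∂Λ_r`. Abstract; no definitions.
-/

namespace Summit.Ventures.PercRepro0.Planar

/-- Discrete intermediate value theorem for integer sequences with steps in `{-1, 0, 1}`. -/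
theorem exists_eq_of_step_le_one (f : ℕ → ℤ) (hstep : ∀ i, |f (i + 1) - f i| ≤ 1) (r : ℤ)
    {m : ℕ} (h0 : f 0 ≤ r) (hm : r ≤ f m) : ∃ i, i ≤ m ∧ f i = r := by
  induction m with
  | zero => exact ⟨0, le_refl _, le_antisymm h0 hm⟩
  | succ n ih =>
    by_cases hn : r ≤ f n
    · obtain ⟨i, hi, hfi⟩ := ih hn
      exact ⟨i, Nat.le_succ_of_le hi, hfi⟩
    · have hn' : f n < r := not_le.mp hn
      -- f n < r ≤ f (n+1) and |f (n+1) - f n| ≤ 1 force f (n+1) = r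
      have h1 := hstep n
      rw [abs_le] at h1
      exact ⟨n + 1, le_refl _, by omega⟩

end Summit.Ventures.PercRepro0.Planar
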